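import Literature.AlgebraicGeometry.ShimuraVarieties.UnitaryBallAlbaneseHodge
import Literature.AlgebraicTopology.FundamentalGroup.EquivariantLiftSurjective
import Literature.Geometry.Kaehler.ComplexTorusCoverQuotientCovering
import HarnessLib
import Literature.AlgebraicGeometry.HodgeTheory.ComplexConjugationHolds

/-!
# The Albanese torus of a compact ball quotient surface is an abelian variety

Layer `Literature/AlgebraicGeometry/ShimuraVarieties`, sequel of `UnitaryBallAlbaneseHodge` (the Albanese
pull-back `alb^* : H¹(T, ℚ) → H¹(X(ℂ); ℚ)` is a morphism of `ℚ`-Hodge structures, and `T = Alb(X)` is an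
abelian variety as soon as `alb^*` is injective).  THEOREMS ONLY (no definition, no named fact).

The injectivity is topology (Griffiths–Harris Ch. 2 §6, Voisin I §12.1.2: `alb_* : π₁(X) → π₁(Alb X) = Λ`
is ONTO, the periods of `Γ = π₁(X(ℂ))` being all of `Λ` by construction), in the form proved by the
tree's `Literature.AlgebraicTopology.FundamentalGroup.injective_singularCohomology_map_one_of_equivariant_vadd`
(an equivariant lift between quotient coverings with surjective group map forces `φ_*` onto `π₁` and `φ^*`
injective on `H¹(·; F)`):

* `isQuotientCoveringMap_modelUnif` — `ψ : 𝔹² → X^an` is a quotient covering for `Δ = ρ_𝔣(Γ)`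
  (`isQuotientCoveringMap_ballUnifMap` through `X^an ≃ₜ X(ℂ)`);
* `injective_singularCohomology_map_albMap` — **`alb^* : H¹(T; ℚ) → H¹(X^an; ℚ)` is injective**: the lift
  `𝒜 : 𝔹² → ℂ^ι` of `alb` is equivariant, `𝒜(γ z) = λ(γ) + 𝒜(z)` (`albLift_smul`), along
  `γ ↦ λ(γ) : Δ ↠ Λ` (the period group IS the image), and `π : ℂ^ι → ℂ^ι / Λ` is the quotient covering
  of the lattice (`ComplexTorus.isAddQuotientCoveringMap_cover`);
* `injective_singularCohomology_map_albTop` — the same on `X(ℂ)`;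
* **`isAbelianVariety_albaneseTorus`** — `ComplexTorus.IsAbelianVariety (periodMatrix …)`: THE ALBANESE
  TORUS `ℂ^q / Λ` (`q = h^{1,0}(X)`) OF A COMPACT BALL QUOTIENT SURFACE CARRIES A RIEMANN FORM, i.e. is
  (the analytic germ of) an abelian variety (Voisin I Cor. 12.12; via `isAbelianVariety_albaneseTorus_of_injective`
  and the real Hodge model `realHodgeModel`).

## References

* [GriffithsHarris1978] P. Griffiths, J. Harris, *Principles of Algebraic Geometry* (1978), Ch. 2 §6.
* [VoisinHodgeI2002] C. Voisin, *Hodge Theory and Complex Algebraic Geometry I* (2002), §12.1.2–12.1.3,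
  Cor. 12.12.
* [HatcherAT2002] A. Hatcher, *Algebraic Topology* (2002), Thm. 2A.1, Prop. 1.40, §3.1 p. 198.
-/

noncomputable section

open scoped Manifold Topology TensorProduct
open CategoryTheory Function Set Module MulAction
open Literature.Geometry.ComplexHyperbolic
open Literature.Geometry.ComplexHyperbolic.BallModel (U21 Ball x₀)
open Literature.Geometry.Kaehler (MForm holFormsInCharts ComplexTorus)
open Literature.NumberTheory.Transcendental
open Literature.AlgebraicTopology.SingularHomology
open Literature.AlgebraicTopology.FundamentalGroup
open Literature.AlgebraicGeometry.Motives (bettiCohomology)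
open Literature.AlgebraicGeometry.HodgeTheory

namespace Literature.AlgebraicGeometry.ShimuraVarieties

namespace UnitaryBallUniformisationDatum

variable {X : Motives.SchemeOver ℂ} (D : UnitaryBallUniformisationDatum 2 X)

/-! ### `ψ : 𝔹² → X^an` is a quotient covering -/

/-- **The uniformisation `ψ : 𝔹² → X^an` (read in a Hodge model) is a quotient covering map** for the
action of `Δ = ρ_𝔣(Γ)` (`isQuotientCoveringMap_ballUnifMap` followed by the homeomorphism `X(ℂ) ≃ₜ X^an`).
[cite: HatcherAT2002, §1.3 Prop. 1.40] -/
theorem isQuotientCoveringMap_modelUnif (A : HodgeModel 2 X) (𝔣 : D.SylvesterFrame) :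
    IsQuotientCoveringMap (fun z : Ball ↦ D.modelUnif A 𝔣 z.1) (D.ballImage 𝔣) :=
  (D.isQuotientCoveringMap_ballUnifMap 𝔣).homeomorph_comp A.isAnalytification.homeomorph.symm

variable (𝔣 : D.SylvesterFrame) {ι : Type} [Fintype ι]
  (b : Basis ι ℂ (holFormsInCharts (Fin 2 → ℂ) (stdCarrier D.isSmoothProjective).carrier 1))

/-! ### `alb^*` is injective on `H¹(·; ℚ)` -/

/-- **`alb^* : H¹(T; ℚ) → H¹(X^an; ℚ)` is injective** (equivalently `alb_*` maps `π₁(X^an) ≅ Γ` onto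
`π₁(T) = Λ`): the lift `𝒜` of `alb` to the universal covers `𝔹² → ℂ^ι` is equivariant along the
SURJECTION `Δ ↠ Λ`, `ρ_𝔣(γ) ↦ λ(γ)` (`albLift_smul`; `Λ` is the image of `Γ` by definition).
[cite: GriffithsHarris1978, Ch. 2 §6] [cite: HatcherAT2002, Thm. 2A.1 and §3.1 p. 198] -/
theorem injective_singularCohomology_map_albMap :
    Function.Injective (singularCohomology.map ℚ ℚ
      (⟨D.albMap (intModel D.isSmoothProjective) 𝔣 b,
        D.continuous_albMap (intModel D.isSmoothProjective) 𝔣 b⟩ :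
        C((stdCarrier D.isSmoothProjective).carrier,
          D.AlbaneseTorus (intModel D.isSmoothProjective) 𝔣 b)) 1) := by
  classical
  haveI := BallModel.instPathConnectedSpaceBall
  -- the lattice as an additive subgroup with carrier `Φ(ℤ^{2q})`
  have hΛ : ((D.periodLattice (intModel D.isSmoothProjective) 𝔣 b : AddSubgroup (ι → ℂ)) :
      Set (ι → ℂ)) = Set.range (ComplexTorus.latticeVec (D.periodMatrix (intModel D.isSmoothProjective) 𝔣 b)) :=
    ComplexTorus.coe_eq_range_latticeVec_of_mem_iff _ _
      (D.mem_periodLattice_iff_periodMatrix (intModel D.isSmoothProjective) 𝔣 b)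
  -- the group map `Δ → Λ`, `ρ(γ) ↦ λ(γ)`
  have hγ : ∀ g : D.ballImage 𝔣, ∃ γ : D.Γ, D.ballRep 𝔣 γ = g := fun g ↦
    (D.mem_ballImage_iff 𝔣).1 g.2
  choose γ hγ using hγ
  let τ : D.ballImage 𝔣 → D.periodLattice (intModel D.isSmoothProjective) 𝔣 b := fun g ↦
    ⟨D.periodVec (intModel D.isSmoothProjective) 𝔣 b (γ g),
      D.periodVec_mem_periodLattice (intModel D.isSmoothProjective) 𝔣 b (γ g)⟩
  have hτ : Function.Surjective τ := by
    rintro ⟨ℓ, hℓ⟩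
    obtain ⟨δ, rfl⟩ := (D.mem_periodLattice_iff (intModel D.isSmoothProjective) 𝔣 b).1 hℓ
    refine ⟨D.ballImageMk 𝔣 δ, Subtype.ext ?_⟩
    have hδ : γ (D.ballImageMk 𝔣 δ) = δ :=
      D.ballRep_injective 𝔣 (by rw [hγ]; rfl)
    change D.periodVec (intModel D.isSmoothProjective) 𝔣 b (γ (D.ballImageMk 𝔣 δ)) = _
    rw [hδ]
  refine injective_singularCohomology_map_one_of_equivariant_vadd ℚ
    (D.isQuotientCoveringMap_modelUnif (intModel D.isSmoothProjective) 𝔣)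
    (ComplexTorus.isAddQuotientCoveringMap_cover (D.periodMatrix (intModel D.isSmoothProjective) 𝔣 b) _ hΛ)
    ⟨D.albLift (intModel D.isSmoothProjective) 𝔣 b, D.continuous_albLift (intModel D.isSmoothProjective) 𝔣 b⟩
    _ τ hτ (fun z ↦ (D.albMap_modelUnif (intModel D.isSmoothProjective) 𝔣 b z).symm) (fun g z ↦ ?_) x₀
  -- equivariance `𝒜(g z) = λ(γ) + 𝒜(z)`
  change D.albLift (intModel D.isSmoothProjective) 𝔣 b ((g : U21) • z) =
    (D.periodVec (intModel D.isSmoothProjective) 𝔣 b (γ g) : ι → ℂ) +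
      D.albLift (intModel D.isSmoothProjective) 𝔣 b z
  rw [← hγ g, D.albLift_smul (intModel D.isSmoothProjective) 𝔣 b (γ g) z, add_comm]

/-- **`alb^* : H¹(T; ℚ) → H¹(X(ℂ); ℚ)` is injective** (the previous statement transported along the
homeomorphism `X^an ≃ₜ X(ℂ)`). [cite: GriffithsHarris1978, Ch. 2 §6] -/
theorem injective_singularCohomology_map_albTop :
    Function.Injective (singularCohomology.map ℚ ℚ (D.albTop 𝔣 b) 1) := by
  have hX := D.isSmoothProjective
  set e : C((stdCarrier hX).carrier, Motives.ComplexPoints X) :=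
    ⟨(stdCarrier hX).toComplexPoints, (stdCarrier hX).isAnalytification.isHomeomorph.continuous⟩ with he
  set e' : C(Motives.ComplexPoints X, (stdCarrier hX).carrier) :=
    ⟨(stdCarrier hX).isAnalytification.homeomorph.symm,
      (stdCarrier hX).isAnalytification.homeomorph.symm.continuous⟩ with he'
  -- `albTop = albMap ∘ e'` and `e ∘ e' = id`
  have h1 : D.albTop 𝔣 b =
      (⟨D.albMap (intModel hX) 𝔣 b, D.continuous_albMap (intModel hX) 𝔣 b⟩ :
        C((stdCarrier hX).carrier, D.AlbaneseTorus (intModel hX) 𝔣 b)).comp e' := rfl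
  have h2 : e'.comp e = ContinuousMap.id _ :=
    ContinuousMap.ext fun x ↦ (stdCarrier hX).isAnalytification.homeomorph.symm_apply_apply x
  -- `e'^*` is injective (`e'^* ≫ e^* = (e' ∘ e)^* = id`)
  have he'inj : Function.Injective (singularCohomology.map ℚ ℚ e' 1) := by
    intro u v huv
    have := congrArg (singularCohomology.map ℚ ℚ e 1) huv
    rwa [← ModuleCat.comp_apply, ← ModuleCat.comp_apply, ← singularCohomology.map_comp, h2,
      singularCohomology.map_id, ModuleCat.id_apply, ModuleCat.id_apply] at this
  rw [h1, singularCohomology.map_comp]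
  intro u v huv
  rw [ModuleCat.comp_apply, ModuleCat.comp_apply] at huv
  exact D.injective_singularCohomology_map_albMap 𝔣 b (he'inj huv)

/-! ### The Albanese torus is an abelian variety -/

/-- **The Albanese torus of a compact ball quotient surface is an abelian variety**: the complex torus
`ℂ^ι / Λ` (`Λ` the period lattice of the holomorphic `1`-forms, `|ι| = q = h^{1,0}(X)`) admits a Riemann
form — the polarisation of `H¹(X(ℂ); ℚ)` restricted along the injective morphism of Hodge structures
`alb^*` (`isAbelianVariety_albaneseTorus_of_injective` with the real Hodge model `realHodgeModel`).
[cite: VoisinHodgeI2002, §12.1.3 Cor. 12.12] [cite: GriffithsHarris1978, Ch. 2 §6] -/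
theorem isAbelianVariety_albaneseTorus :
    ComplexTorus.IsAbelianVariety (D.periodMatrix (intModel D.isSmoothProjective) 𝔣 b) :=
  D.isAbelianVariety_albaneseTorus_of_injective 𝔣 b (BettiUniverse.realHodgeModel exists_isReal_hodgeModel_holds D.isSmoothProjective)
    (BettiUniverse.realHodgeModel_isHodgeSymmetric exists_isReal_hodgeModel_holds D.isSmoothProjective)
    (D.injective_singularCohomology_map_albTop 𝔣 b)

end UnitaryBallUniformisationDatum

end Literature.AlgebraicGeometry.ShimuraVarieties

end
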